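import Summits.CriticalPhenomena.Ising3DConformalLimit.Theorems.AnomalousForcesInteractionGaussianLimitIsFreeExplainedVariance
import Literature.Probability.LatticeModels.CriticalWickIff
import HarnessLib

/-!
# Crux `GaussianLimitIsFree` (item stmt-CriticalPhenomena-2601), line `registered`, skeleton v12 (lead c5):
# the registered stub is EQUIVALENT to the crux

THEOREM-ONLY file (`--supports stmt-CriticalPhenomena-2601`, registered sub-goal `stub_usc_iff_crux`).
Skeleton v12 has one stub, `stub_explainedVariance_usc` (upper semicontinuity of the explained variance of
an interior observable by the collar events along the realising lattice sequence, for a GAUSSIAN realised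
limit with `Δ > 1/2`).  `GaussianLimitIsFree_of_usc` (…ExplainedVariance.lean) derives the crux from it.
This file proves the converse, so that the line's bookkeeping is closed by a kernel-checked equivalence:

* `limitConnectedFour_eq_zero_of_wickForm`, `not_hasNontrivialU4_of_wickForm` — a family of the form
  `S = (√A)ⁿ · W_Δ` (`wickPower`) has `U₄^S ≡ 0` on non-coincident configurations;
* `usc_of_GaussianLimitIsFree` — the crux implies the stub: under the stub's hypotheses `S` is such a family
  and a pointwise limit of `criticalCorr 3`, so the crux forces `Δ = 1/2`, contradicting `1/2 < Δ` — the
  stub holds vacuously;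
* `usc_iff_GaussianLimitIsFree` (= `stub_usc_iff_crux`) — **`stub_explainedVariance_usc ↔ GaussianLimitIsFree`.**

Reading: the Markov-inheritance line has been reduced, by tree theorems only, to a single statement that is
provably neither weaker nor stronger than the crux; it isolates WHERE a proof must work (an upper bound on
the predictive power of the microscopic collar spins along `μ_δ ⇀ μ`) but cannot make the crux cheaper.  The
same equivalence is not available for the v11 stub (decoupling (D_ε) for the limit law at every `Δ`), whose
`Δ = 1/2` instance is the Markov property of the massless free field, not in the tree.

References: C. M. Newman, CMP 41 (1975); M. Aizenman, CMP 86 (1982) Prop. 12.1; Yu. A. Rozanov (1982) Ch. 2.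
-/

noncomputable section

namespace Summit.CriticalPhenomena.Ising3DConformalLimit.Cruxes.GaussianLimitIsFree.Birth

open MeasureTheory Filter Set
open Literature.MathematicalPhysics.QuantumLattice
open Literature.Probability.LatticeModels
open Summit.CriticalPhenomena.Ising3DConformalLimit.Theses.AnomalousForcesInteraction (GaussianLimitIsFree)
open Summit.CriticalPhenomena.Ising3DConformalLimit.MoebiusLimitExistsOnlyInteraction

/-! ### Wick families have `U₄ ≡ 0` -/

/-- The two-point entries of a Wick family `S = (√A)ⁿ·W_Δ` at distinct points:
`S₂(p, q) = A ‖p − q‖^{-2Δ}`. [folklore] -/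
theorem two_of_wickForm {Δ A : ℝ} {S : CorrFamily 3} (hA : 0 ≤ A)
    (hS : ∀ (n : ℕ) (x : Fin n → EuclideanSpace ℝ (Fin 3)), S n x = Real.sqrt A ^ n * wickPower Δ n x)
    {p q : EuclideanSpace ℝ (Fin 3)} (hpq : p ≠ q) :
    S 2 ![p, q] = A * powerKernel Δ p q := by
  have hmem : (![p, q] : Fin 2 → EuclideanSpace ℝ (Fin 3)) ∈ NonCoincident 3 2 :=
    pair_mem_nonCoincident hpq
  rw [hS 2, wickPower_two hmem, Real.sq_sqrt hA]
  rfl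

/-- **A Wick family has vanishing connected four-point function on non-coincident configurations**:
for `S = (√A)ⁿ·W_Δ` (`A ≥ 0`) and `z ∈ NonCoincident 3 4`, `U₄^S(z) = 0`
(`W_Δ(4) = 𝒢₂[‖·−·‖^{-2Δ}]`, `pairingSum_two`). [cite: AizenmanCMP1982, Prop. 12.1] -/
theorem limitConnectedFour_eq_zero_of_wickForm {Δ A : ℝ} {S : CorrFamily 3} (hA : 0 ≤ A)
    (hS : ∀ (n : ℕ) (x : Fin n → EuclideanSpace ℝ (Fin 3)), S n x = Real.sqrt A ^ n * wickPower Δ n x)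
    {z : Fin 4 → EuclideanSpace ℝ (Fin 3)} (hz : z ∈ NonCoincident 3 4) :
    limitConnectedFour S z = 0 := by
  have hinj : Function.Injective z := hz
  have hne : ∀ {i j : Fin 4}, i ≠ j → z i ≠ z j := fun hij h => hij (hinj h)
  have h4 : S 4 z = A ^ 2 * (powerKernel Δ (z 0) (z 1) * powerKernel Δ (z 2) (z 3)
      + powerKernel Δ (z 0) (z 2) * powerKernel Δ (z 1) (z 3)
      + powerKernel Δ (z 0) (z 3) * powerKernel Δ (z 1) (z 2)) := by
    have hz' : (z : Fin (2 * 2) → EuclideanSpace ℝ (Fin 3)) ∈ NonCoincident 3 (2 * 2) := hz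
    have e := wickPower_of_mem_even (Δ := Δ) (m := 2) hz'
    rw [pairingSum_two _ (powerKernel_comm Δ)] at e
    have hsq : Real.sqrt A ^ 4 = A ^ 2 := by
      rw [show (4 : ℕ) = 2 * 2 from rfl, pow_mul, Real.sq_sqrt hA]
    rw [hS 4, hsq]
    exact congrArg (A ^ 2 * ·) e
  unfold limitConnectedFour
  rw [h4, two_of_wickForm hA hS (hne (by decide : (0 : Fin 4) ≠ 1)),
    two_of_wickForm hA hS (hne (by decide : (2 : Fin 4) ≠ 3)),
    two_of_wickForm hA hS (hne (by decide : (0 : Fin 4) ≠ 2)),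
    two_of_wickForm hA hS (hne (by decide : (1 : Fin 4) ≠ 3)),
    two_of_wickForm hA hS (hne (by decide : (0 : Fin 4) ≠ 3)),
    two_of_wickForm hA hS (hne (by decide : (1 : Fin 4) ≠ 2))]
  ring

/-- **A Wick family fails `HasNontrivialU4`.** [cite: AizenmanCMP1982, Prop. 12.1] -/
theorem not_hasNontrivialU4_of_wickForm {Δ A : ℝ} {S : CorrFamily 3} (hA : 0 ≤ A)
    (hS : ∀ (n : ℕ) (x : Fin n → EuclideanSpace ℝ (Fin 3)), S n x = Real.sqrt A ^ n * wickPower Δ n x) :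
    ¬ HasNontrivialU4 S := by
  rintro ⟨z, hz, hne⟩
  exact hne (limitConnectedFour_eq_zero_of_wickForm hA hS hz)

/-! ### The crux implies the stub; the equivalence -/

/-- **The crux implies the v12 stub**: under the hypotheses of `stub_explainedVariance_usc` the family `S`
is a Wick family `(√A)ⁿ·W_Δ` and a non-degenerate translation-invariant scale-covariant pointwise limit of
`criticalCorr 3`, so `GaussianLimitIsFree` gives `Δ = 1/2`, contradicting the stub's hypothesis `1/2 < Δ`:
the stub's conclusion holds vacuously. [folklore] -/
theorem usc_of_GaussianLimitIsFree (hGF : GaussianLimitIsFree) :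
    ∀ (ρ : ℝ → ℝ) (Δ A : ℝ) (S : Literature.Probability.LatticeModels.CorrFamily 3) (μ : MeasureTheory.Measure (Literature.MathematicalPhysics.QuantumLattice.FieldConfig (EuclideanSpace ℝ (Fin 3)))), (∀ δ ∈ Set.Ioc (0:ℝ) 1, 0 < ρ δ) → Literature.Probability.LatticeModels.HasPointwiseScalingLimit (Literature.Probability.LatticeModels.criticalCorr 3) ρ S → (∀ n z, z ∉ Literature.Probability.LatticeModels.NonCoincident 3 n → S n z = 0) → Literature.Probability.LatticeModels.IsNondegenerateTwoPoint S → Literature.Probability.LatticeModels.IsTranslationInvariant S → Literature.Probability.LatticeModels.IsScaleCovariant Δ S → 1 / 2 < Δ → 0 < A → (∀ (n : ℕ) (x : Fin n → EuclideanSpace ℝ (Fin 3)), S n x = Real.sqrt A ^ n * Summit.CriticalPhenomena.Ising3DConformalLimit.MoebiusLimitExistsOnlyInteraction.wickPower Δ n x) → MeasureTheory.IsProbabilityMeasure μ → Literature.MathematicalPhysics.QuantumLattice.HasAllMoments μ → (∀ f : SchwartzMap (EuclideanSpace ℝ (Fin 3)) ℝ, MeasureTheory.Integrable (fun ω : Literature.MathematicalPhysics.QuantumLattice.FieldConfig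 (EuclideanSpace ℝ (Fin 3)) => Real.exp (ω f)) μ) → (∀ (n : ℕ) (f : Fin n → SchwartzMap (EuclideanSpace ℝ (Fin 3)) ℝ), Literature.MathematicalPhysics.QuantumLattice.moment μ n f = ∫ x : Fin n → EuclideanSpace ℝ (Fin 3), S n x * ∏ i, f i (x i)) → Literature.MathematicalPhysics.QuantumLattice.IsGaussianField μ → ∀ (ν : MeasureTheory.Measure (Literature.Probability.LatticeModels.SpinConfig (Literature.Probability.LatticeModels.Site 3))), ν ∈ Literature.Probability.LatticeModels.isingGibbsMeasures 3 (Literature.Probability.LatticeModels.criticalBeta 3) 0 → (∀ B : Finset (Literature.Probability.LatticeModels.Site 3), Literature.Probability.LatticeModels.spinCorr ν B = Literature.Probability.LatticeModels.plusCorr 3 (Literature.Probability.LatticeModels.criticalBeta 3) 0 B) → Literature.MathematicalPhysics.QuantumLattice.TendstoInLaw (fun δ : ℝ => Literature.MathematicalPhysics.QuantumLattice.spinFieldLaw ν (Literature.Probability.LatticeModels.box 3 ⌊δ⁻¹ ^ 2⌋₊) δ (ρ δ)) (nhdsWithin (0 : ℝ) (Set.Ioi 0)) μ → ∀ (ε :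 ℝ), 0 < ε → ∀ (w : SchwartzMap (EuclideanSpace ℝ (Fin 3)) ℝ), tsupport ⇑w ⊆ Metric.ball (0 : EuclideanSpace ℝ (Fin 3)) 1 → ∀ (η : ℝ), 0 < η → Filter.Eventually (fun δ : ℝ => ∫ ω, (MeasureTheory.condExp (Literature.MathematicalPhysics.QuantumLattice.fieldSigma (Metric.thickening ε (Metric.sphere (0 : EuclideanSpace ℝ (Fin 3)) 1))) (Literature.MathematicalPhysics.QuantumLattice.spinFieldLaw ν (Literature.Probability.LatticeModels.box 3 ⌊δ⁻¹ ^ 2⌋₊) δ (ρ δ)) (fun ω : Literature.MathematicalPhysics.QuantumLattice.FieldConfig (EuclideanSpace ℝ (Fin 3)) => ω w)) ω ^ 2 ∂(Literature.MathematicalPhysics.QuantumLattice.spinFieldLaw ν (Literature.Probability.LatticeModels.box 3 ⌊δ⁻¹ ^ 2⌋₊) δ (ρ δ)) ≤ (∫ ω, (MeasureTheory.condExp (Literature.MathematicalPhysics.QuantumLattice.fieldSigma (Metric.thickening ε (Metric.sphere (0 : EuclideanSpace ℝ (Fin 3)) 1))) μ (fun ω : Literature.MathematicalPhysics.QuantumLattice.FieldConfig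 (EuclideanSpace ℝ (Fin 3)) => ω w)) ω ^ 2 ∂μ) + η) (nhdsWithin (0 : ℝ) (Set.Ioi 0)) := by
  intro ρ Δ A S _μ hρ hlim _hzero hnd htr hsc hlt hA hS _hP _hall _hexp _hmom _hG _ν _hνG _hν _hlaw
    _ε _hε _w _hw _η _hη
  exfalso
  have h := hGF ρ Δ S hρ hlim hnd htr hsc (not_hasNontrivialU4_of_wickForm hA.le hS)
  linarith

/-- **`stub_explainedVariance_usc ↔ GaussianLimitIsFree`**: the single registered stub of skeleton v12 of
the line `registered` is EQUIVALENT to the crux (`GaussianLimitIsFree_of_usc` and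
`usc_of_GaussianLimitIsFree`). [folklore] -/
theorem usc_iff_GaussianLimitIsFree :
    (∀ (ρ : ℝ → ℝ) (Δ A : ℝ) (S : Literature.Probability.LatticeModels.CorrFamily 3) (μ : MeasureTheory.Measure (Literature.MathematicalPhysics.QuantumLattice.FieldConfig (EuclideanSpace ℝ (Fin 3)))), (∀ δ ∈ Set.Ioc (0:ℝ) 1, 0 < ρ δ) → Literature.Probability.LatticeModels.HasPointwiseScalingLimit (Literature.Probability.LatticeModels.criticalCorr 3) ρ S → (∀ n z, z ∉ Literature.Probability.LatticeModels.NonCoincident 3 n → S n z = 0) → Literature.Probability.LatticeModels.IsNondegenerateTwoPoint S → Literature.Probability.LatticeModels.IsTranslationInvariant S → Literature.Probability.LatticeModels.IsScaleCovariant Δ S → 1 / 2 < Δ → 0 < A → (∀ (n : ℕ) (x : Fin n → EuclideanSpace ℝ (Fin 3)), S n x = Real.sqrt A ^ n * Summit.CriticalPhenomena.Ising3DConformalLimit.MoebiusLimitExistsOnlyInteraction.wickPower Δ n x) → MeasureTheory.IsProbabilityMeasure μ → Literature.MathematicalPhysics.QuantumLattice.HasAllMoments μ → (∀ f : SchwartzMap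 (EuclideanSpace ℝ (Fin 3)) ℝ, MeasureTheory.Integrable (fun ω : Literature.MathematicalPhysics.QuantumLattice.FieldConfig (EuclideanSpace ℝ (Fin 3)) => Real.exp (ω f)) μ) → (∀ (n : ℕ) (f : Fin n → SchwartzMap (EuclideanSpace ℝ (Fin 3)) ℝ), Literature.MathematicalPhysics.QuantumLattice.moment μ n f = ∫ x : Fin n → EuclideanSpace ℝ (Fin 3), S n x * ∏ i, f i (x i)) → Literature.MathematicalPhysics.QuantumLattice.IsGaussianField μ → ∀ (ν : MeasureTheory.Measure (Literature.Probability.LatticeModels.SpinConfig (Literature.Probability.LatticeModels.Site 3))), ν ∈ Literature.Probability.LatticeModels.isingGibbsMeasures 3 (Literature.Probability.LatticeModels.criticalBeta 3) 0 → (∀ B : Finset (Literature.Probability.LatticeModels.Site 3), Literature.Probability.LatticeModels.spinCorr ν B = Literature.Probability.LatticeModels.plusCorr 3 (Literature.Probability.LatticeModels.criticalBeta 3) 0 B) → Literature.MathematicalPhysics.QuantumLattice.TendstoInLaw (fun δ : ℝ => Literature.MathematicalPhysics.QuantumLattice.spinFieldLaw ν (Literature.Probability.LatticeModels.box 3 ⌊δ⁻¹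 ^ 2⌋₊) δ (ρ δ)) (nhdsWithin (0 : ℝ) (Set.Ioi 0)) μ → ∀ (ε : ℝ), 0 < ε → ∀ (w : SchwartzMap (EuclideanSpace ℝ (Fin 3)) ℝ), tsupport ⇑w ⊆ Metric.ball (0 : EuclideanSpace ℝ (Fin 3)) 1 → ∀ (η : ℝ), 0 < η → Filter.Eventually (fun δ : ℝ => ∫ ω, (MeasureTheory.condExp (Literature.MathematicalPhysics.QuantumLattice.fieldSigma (Metric.thickening ε (Metric.sphere (0 : EuclideanSpace ℝ (Fin 3)) 1))) (Literature.MathematicalPhysics.QuantumLattice.spinFieldLaw ν (Literature.Probability.LatticeModels.box 3 ⌊δ⁻¹ ^ 2⌋₊) δ (ρ δ)) (fun ω : Literature.MathematicalPhysics.QuantumLattice.FieldConfig (EuclideanSpace ℝ (Fin 3)) => ω w)) ω ^ 2 ∂(Literature.MathematicalPhysics.QuantumLattice.spinFieldLaw ν (Literature.Probability.LatticeModels.box 3 ⌊δ⁻¹ ^ 2⌋₊) δ (ρ δ)) ≤ (∫ ω, (MeasureTheory.condExp (Literature.MathematicalPhysics.QuantumLattice.fieldSigma (Metric.thickening ε (Metric.sphere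 (0 : EuclideanSpace ℝ (Fin 3)) 1))) μ (fun ω : Literature.MathematicalPhysics.QuantumLattice.FieldConfig (EuclideanSpace ℝ (Fin 3)) => ω w)) ω ^ 2 ∂μ) + η) (nhdsWithin (0 : ℝ) (Set.Ioi 0))) ↔ GaussianLimitIsFree :=
  ⟨GaussianLimitIsFree_of_usc, usc_of_GaussianLimitIsFree⟩

/-- **Registered form (sub-goal `stub_usc_iff_crux` of crux stmt-CriticalPhenomena-2601, skeleton v12)** —
`usc_iff_GaussianLimitIsFree` with the crux spelled out. [folklore] -/
theorem stub_usc_iff_crux :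
    (∀ (ρ : ℝ → ℝ) (Δ A : ℝ) (S : Literature.Probability.LatticeModels.CorrFamily 3) (μ : MeasureTheory.Measure (Literature.MathematicalPhysics.QuantumLattice.FieldConfig (EuclideanSpace ℝ (Fin 3)))), (∀ δ ∈ Set.Ioc (0:ℝ) 1, 0 < ρ δ) → Literature.Probability.LatticeModels.HasPointwiseScalingLimit (Literature.Probability.LatticeModels.criticalCorr 3) ρ S → (∀ n z, z ∉ Literature.Probability.LatticeModels.NonCoincident 3 n → S n z = 0) → Literature.Probability.LatticeModels.IsNondegenerateTwoPoint S → Literature.Probability.LatticeModels.IsTranslationInvariant S → Literature.Probability.LatticeModels.IsScaleCovariant Δ S → 1 / 2 < Δ → 0 < A → (∀ (n : ℕ) (x : Fin n → EuclideanSpace ℝ (Fin 3)), S n x = Real.sqrt A ^ n * Summit.CriticalPhenomena.Ising3DConformalLimit.MoebiusLimitExistsOnlyInteraction.wickPower Δ n x) → MeasureTheory.IsProbabilityMeasure μ → Literature.MathematicalPhysics.QuantumLattice.HasAllMoments μ → (∀ f : SchwartzMap (EuclideanSpace ℝ (Fin 3)) ℝ, MeasureTheory.Integrable (fun ω : Literature.MathematicalPhysics.QuantumLattice.FieldConfig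 (EuclideanSpace ℝ (Fin 3)) => Real.exp (ω f)) μ) → (∀ (n : ℕ) (f : Fin n → SchwartzMap (EuclideanSpace ℝ (Fin 3)) ℝ), Literature.MathematicalPhysics.QuantumLattice.moment μ n f = ∫ x : Fin n → EuclideanSpace ℝ (Fin 3), S n x * ∏ i, f i (x i)) → Literature.MathematicalPhysics.QuantumLattice.IsGaussianField μ → ∀ (ν : MeasureTheory.Measure (Literature.Probability.LatticeModels.SpinConfig (Literature.Probability.LatticeModels.Site 3))), ν ∈ Literature.Probability.LatticeModels.isingGibbsMeasures 3 (Literature.Probability.LatticeModels.criticalBeta 3) 0 → (∀ B : Finset (Literature.Probability.LatticeModels.Site 3), Literature.Probability.LatticeModels.spinCorr ν B = Literature.Probability.LatticeModels.plusCorr 3 (Literature.Probability.LatticeModels.criticalBeta 3) 0 B) → Literature.MathematicalPhysics.QuantumLattice.TendstoInLaw (fun δ : ℝ => Literature.MathematicalPhysics.QuantumLattice.spinFieldLaw ν (Literature.Probability.LatticeModels.box 3 ⌊δ⁻¹ ^ 2⌋₊) δ (ρ δ)) (nhdsWithin (0 : ℝ) (Set.Ioi 0)) μ → ∀ (ε :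 ℝ), 0 < ε → ∀ (w : SchwartzMap (EuclideanSpace ℝ (Fin 3)) ℝ), tsupport ⇑w ⊆ Metric.ball (0 : EuclideanSpace ℝ (Fin 3)) 1 → ∀ (η : ℝ), 0 < η → Filter.Eventually (fun δ : ℝ => ∫ ω, (MeasureTheory.condExp (Literature.MathematicalPhysics.QuantumLattice.fieldSigma (Metric.thickening ε (Metric.sphere (0 : EuclideanSpace ℝ (Fin 3)) 1))) (Literature.MathematicalPhysics.QuantumLattice.spinFieldLaw ν (Literature.Probability.LatticeModels.box 3 ⌊δ⁻¹ ^ 2⌋₊) δ (ρ δ)) (fun ω : Literature.MathematicalPhysics.QuantumLattice.FieldConfig (EuclideanSpace ℝ (Fin 3)) => ω w)) ω ^ 2 ∂(Literature.MathematicalPhysics.QuantumLattice.spinFieldLaw ν (Literature.Probability.LatticeModels.box 3 ⌊δ⁻¹ ^ 2⌋₊) δ (ρ δ)) ≤ (∫ ω, (MeasureTheory.condExp (Literature.MathematicalPhysics.QuantumLattice.fieldSigma (Metric.thickening ε (Metric.sphere (0 : EuclideanSpace ℝ (Fin 3)) 1))) μ (fun ω : Literature.MathematicalPhysics.QuantumLattice.FieldConfig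 (EuclideanSpace ℝ (Fin 3)) => ω w)) ω ^ 2 ∂μ) + η) (nhdsWithin (0 : ℝ) (Set.Ioi 0))) ↔ Summit.CriticalPhenomena.Ising3DConformalLimit.Theses.AnomalousForcesInteraction.GaussianLimitIsFree :=
  usc_iff_GaussianLimitIsFree

end Summit.CriticalPhenomena.Ising3DConformalLimit.Cruxes.GaussianLimitIsFree.Birth

end
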